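import Literature.NumberTheory.EllipticCurves.EmertonPollackWeston2006.MuAnTransferGoodOrdinary
import Literature.NumberTheory.EllipticCurves.PAdicLFunctionMultiplicativeInterpolation
import Literature.NumberTheory.EllipticCurves.PAdicBSD
import HarnessLib

/-!
# Emerton–Pollack–Weston 2006, Theorem 1 (analytic half): `μ^an = 0` passes from an elliptic curve
# good ordinary at `p ≥ 5` to a `p`-congruent elliptic curve multiplicative at `p` (named fact)

ONE named fact (`def … : Prop`, D-0014, nothing asserted): the sibling of
`EmertonPollackWeston2006.thm1_muAn_transfer_of_torsionIso` (two GOOD ORDINARY members of `H(ρ̄)`)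
with the TARGET member the weight-two newform of an elliptic curve with MULTIPLICATIVE reduction at
`p` (a `p`-ordinary `p`-stabilized newform with `p` in the level; EPW Ex. 5.3.1 runs the theory on
`X₀(11)` at `p = 11`). Hypothesis side byte-identical to the sibling; conclusion side byte-identical to
the body of the Summits-side certificate `X11a.MuAnZeroAt` (Néron-normalised Mazur–Tate–Teitelbaum
function at a multiplicative prime, split / non-split). Consumer: cell `bsd-print-x11a` seat p2
(`Summits/BirchSwinnertonDyer/BirchSwinnertonDyer/Theorems/PrintX11aLowerHalfMuTransport.lean`).

References: M. Emerton, R. Pollack, T. Weston, Invent. Math. 163 (2006) 523–580, Thm. 1, §2.6,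
Prop. 4.1.4, Ex. 5.3.1 [EmertonPollackWeston2006]; R. Greenberg, V. Vatsal, Invent. Math. 142 (2000)
§3 Prop. (3.1), Rem. (3.4) [GreenbergVatsal2000]; C. Skinner, Pacific J. Math. 283 (2016) §3.3
[Skinner2016PacificMC].
-/

open scoped Classical MatrixGroups ModularForm

open CongruenceSubgroup WeierstrassCurve Literature.NumberTheory.EllipticCurves
  Literature.NumberTheory.EllipticCurves.ModularForms Literature.NumberTheory.EllipticCurves.Rank1Residual
  Literature.NumberTheory.EllipticCurves.GreenbergVatsal2000

namespace Literature.NumberTheory.EllipticCurves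

/-- **Emerton–Pollack–Weston 2006, Theorem 1 (analytic half), from an elliptic curve GOOD ORDINARY at
`p ≥ 5` to a `p`-congruent elliptic curve MULTIPLICATIVE at `p`, isomorphic irreducible
`p`-torsion.** M. Emerton, R. Pollack, T. Weston, *Variation of Iwasawa invariants in Hida families*,
Invent. Math. 163 (2006) 523–580 = arXiv:math/0404484, Theorem 1 (p. 2; held text
`paper:arxiv-math_0404484` chunk p0002 L33–L37, verbatim): "Fix `∗ ∈ {alg, an}`. If `μ^∗(f₀) = 0`
for some `f₀ ∈ H(ρ̄)`, then `μ^∗(f) = 0` for all `f ∈ H(ρ̄)`", where (pp. 1–2, chunk p0002 L3–L13)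
"`ρ̄ : G_ℚ → GL₂(k)` [is] an absolutely irreducible modular Galois representation over a finite field
`k` of characteristic `p` … `p`-ordinary and `p`-distinguished in the sense that the restriction of
`ρ̄` to a decomposition group at `p` is reducible and non-scalar" and "the Hida family `H(ρ̄)` of `ρ̄`
is the set of all `p`-ordinary `p`-stabilized newforms `f` with mod `p` Galois representation
isomorphic to `ρ̄`" (all tame levels: Thm. 2, p. 2, compares members "over all primes dividing the
tame level of `f₁` or `f₂`"); `μ^an(f)` is "the exponent of the power of `p` dividing" the `p`-adic
`L`-function of `f` (p. 2), "computed with respect to a canonical period" (Prop. 4.1.4, p. 21, chunk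
p0021 L20–L32, L95–L113). The family CONTAINS the weight-two newform of an elliptic curve with
multiplicative reduction at `p` (a `p`-ordinary `p`-stabilized newform with `p` in the level, `U_p`
eigenvalue `a_p = ±1`): Example 5.3.1 (p. 32, chunk p0032 L22–L75) runs Theorem 1 / Cor. 5.1.4 on
`H(ρ̄_f)` for `f` the newform of `X₀(11)` at `p = 11`, "since `X₀(11)` has split multiplicative
reduction at `p = 11`, the `p`-adic `L`-function `L_p^an(f,T)` has a trivial zero at `T = 0` … so
that `λ^an(f) = 1` and `μ^an(f) = 0`". TRANSCRIPTION (`∗ = an`, `f₀ = ` the `p`-stabilisation of the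
newform of `W₁`, `f = ` the newform of `W₂`): `W₁, W₂/ℚ` globally minimal, `5 ≤ p` (narrower than
print's odd `p`), `W₁` GOOD ORDINARY at `p` (`HasGoodReductionAtPrime`, `p ∤ a_p`), `W₂`
MULTIPLICATIVE at `p` (`HasMultiplicativeReductionAtPrime`), a `Γ_ℚ`-equivariant additive isomorphism
`W₁[p] ≃ W₂[p]` and `W₁[p]` irreducible (so `ρ̄` is absolutely irreducible — odd, irreducible,
two-dimensional in odd characteristic — `p`-ordinary and `p`-distinguished: on inertia at `p` the
diagonal characters are `ω ≠ 1` and `1`; `det ρ̄ = ω` is ramified at `p`, so `ρ̄` has exactly ONE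
`p`-stabilisation, §2.6 p. 13, and both members lie in the same `H(ρ̄)`); HYPOTHESIS "`μ^an(f₀) = 0`"
spelled EXACTLY as in the sibling fact `EmertonPollackWeston2006.thm1_muAn_transfer_of_torsionIso`
(the cell's Néron normalisation at a good ordinary prime: some coefficient of `ϖ₁·L_p(f₁, α)`,
`ϖ₁·Ω_{W₁} = Ω⁺_{f₁}`, `α = unitRoot W₁ p`, is a `p`-adic unit); CONCLUSION "`μ^an(f) = 0`" spelled
EXACTLY as the body of the X11a certificate `Summit.BirchSwinnertonDyer.Rank1Residual.X11a.MuAnZeroAt W₂ p`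
(the Néron normalisation at a multiplicative prime: for every newform `f₂` of `W₂`, any level, and
every `ϖ₂ ∈ ℚ` with `ϖ₂·Ω_{W₂} = Ω⁺_{f₂}`, some coefficient of `ϖ₂·L` is a `p`-adic unit, `L` THE
non-split Mazur–Tate–Teitelbaum function `IsMultPAdicLFunctionOf f₂ p (-1) L` at a non-split `p`,
THE split one `IsSplitMultPAdicLFunctionOf f₂ p L` at a split `p`). Canonical-vs-Néron periods: EPW's
canonical-period `μ^an` agrees with the Néron-normalised one for irreducible `E[p]` at an odd prime of
good ordinary OR multiplicative reduction by Greenberg–Vatsal 2000 §3, Prop. (3.1) ("Assume that `E`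
is optimal in its isogeny class, and that `p` is a prime of either good ordinary or multiplicative
reduction for `E`. Then the numbers `Ω_E^±` and `(−2πi)^± Ω_f^±` are equal up to a factor which is a
`p`-adic unit") and Remark (3.4) ("If `E` does not admit any `p`-isogenies … we obtain `Ω_E^± = Ω_f^±`,
for any choice of sign"), as composed already in the tree's records of Greenberg–Vatsal Thm. (1.4)
(file `GreenbergVatsal2000/CongruentCurves.lean`), of this theorem between two good ordinary curves
(`EmertonPollackWeston2006.thm1_muAn_transfer_of_torsionIso`), and of Cor. 5.1.4 good ordinary →
multiplicative (`EmertonPollackWeston2006.cor514_transfer_of_goodOrdinary`, whose conclusion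
`MultiplicativeCharIdealMuZero` carries `μ = 0` at the multiplicative member in this very
normalisation, read through Skinner 2016 §3.3). Weaker than print, never stronger: two weight-two
members only (one good ordinary, one with `p ‖ N`), `5 ≤ p`, `∗ = an` only, one direction. Named
fact; nothing asserted (inputs: Hida theory for `ρ̄`, two-variable `p`-adic `L`-functions, EPW §§2–4 —
none in Mathlib or the tree); users take `(h : thm1_muAn_transfer_goodOrdinary_to_multiplicative)`.
-- TODO(general form): Theorem 1 for every pair of members of H(ρ̄) (all weights k ≥ 2, twists ω^i,
-- 𝒪-coefficients, any tame levels, odd p), both directions, and ∗ = alg.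
[cite: EmertonPollackWeston2006, Thm. 1 (arXiv:math/0404484 p. 2, held text `paper:arxiv-math_0404484` chunk p0002 L33–L37), Intro pp. 1–2 (H(ρ̄), chunk p0002 L3–L13), §2.6 (p. 13, p-distinguished, p-stabilisations), Prop. 4.1.4 (p. 21, canonical periods), Ex. 5.3.1 (p. 32, X₀(11) at p = 11, chunk p0032 L22–L75)]
[cite: GreenbergVatsal2000, §3, Prop. (3.1) ("either good ordinary or multiplicative reduction"), Remark (3.4), Lemma (3.6), Prop. (3.7) (arXiv:math/9906215 pp. 34–39)]
[cite: Skinner2016PacificMC, §3.3 (arXiv:1407.1093 p0016 L14–L50: canonical vs Néron period at p ‖ N)]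
-/
def thm1_muAn_transfer_goodOrdinary_to_multiplicative : Prop :=
  ∀ (W₁ W₂ : WeierstrassCurve ℚ) [W₁.IsElliptic] [W₁.IsGloballyMinimal]
    [W₂.IsElliptic] [W₂.IsGloballyMinimal] (p : ℕ) [Fact p.Prime],
    5 ≤ p →
    W₁.HasGoodReductionAtPrime p → ¬ (p : ℤ) ∣ W₁.frobeniusTrace p →
    W₂.HasMultiplicativeReductionAtPrime p →
    (∃ e : geomTorsion W₁ (p : ℤ) ≃+ geomTorsion W₂ (p : ℤ),
      ∀ (σ : Field.absoluteGaloisGroup ℚ) (P : geomTorsion W₁ (p : ℤ)), e (σ • P) = σ • e P) →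
    W₁.HasIrreducibleModPGaloisRep p →
    (∀ [NeZero (W₁.conductorNorm ℤ)] (f₁ : CuspForm (Gamma0 (W₁.conductorNorm ℤ)) 2),
        IsNewformOf W₁ f₁ → ∀ (ϖ₁ : ℚ), (ϖ₁ : ℝ) * W₁.realPeriodRat = plusPeriod f₁ →
      ∃ n : ℕ, ‖PowerSeries.coeff n
        (PowerSeries.C (ϖ₁ : ℚ_[p]) * padicLFunction f₁ (unitRoot W₁ p : ℚ_[p]))‖ = 1) →
    ∀ {N : ℕ} [NeZero N] (f₂ : CuspForm (Gamma0 N) 2), IsNewformOf W₂ f₂ →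
      ∀ (ϖ₂ : ℚ), (ϖ₂ : ℝ) * W₂.realPeriodRat = plusPeriod f₂ →
        (¬ W₂.HasSplitMultiplicativeReductionAtPrime p →
          ∀ L : PowerSeries ℚ_[p], IsMultPAdicLFunctionOf f₂ p (-1) L →
            ∃ n : ℕ, ‖PowerSeries.coeff n (PowerSeries.C ((ϖ₂ : ℚ) : ℚ_[p]) * L)‖ = 1) ∧
        (W₂.HasSplitMultiplicativeReductionAtPrime p →
          ∀ L : PowerSeries ℚ_[p], IsSplitMultPAdicLFunctionOf f₂ p L →
            ∃ n : ℕ, ‖PowerSeries.coeff n (PowerSeries.C ((ϖ₂ : ℚ) : ℚ_[p]) * L)‖ = 1)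

end Literature.NumberTheory.EllipticCurves
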